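/-
Copyright (c) 2026 the pub-hodgecm-mathlib formalisation cell (harness21).  Prover seat hodgecm-mathlib-B-p08 (g41): unit U2G_Census (tier-1 assembler), tier-2 spine file 1:
the fixed-coset ↔ fixed-vertex dictionary WITH A PREDICATE (the sibling of ★ `UnitaryThreeFourFrameFixedCosetDictionary`, B-p04 (g61)); 2026-09-03.
-/
import Literature.NumberTheory.Automorphic.UnitaryThreeFourFrameFixedCosetDictionary   -- ★ B-p04 (g61): `mapGL_out_eq`, `mem_fixedBy_quotient_iff_mapGL_eq`, `setOf_orbit_fixed_eq_setOf_isVertexLattice_fixed`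
import HarnessLib

/-!
# The fixed-coset ↔ fixed-vertex dictionary WITH A PREDICATE: `#{gK ∈ Fix_γ(G ⧸ Stab N₀) | P(g⁻¹γg)} = #{M ∈ G·N₀ | γ·M = M ∧ Q(M)}`
# whenever `P(g⁻¹γg) ↔ Q(g·N₀)` on the fixed cosets (Kottwitz 1986 §3; Rogawski 1990 §4.9 p. 54; Laumon 1996 Lemma (5.3.2))

Topic `NumberTheory/Automorphic`; namespace `Literature.NumberTheory.Automorphic.UnitaryThreeFourFrame` (that of ★ `UnitaryThreeFourFrameFixedCosetDictionary`, whose §1–§2 this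
file refines by a predicate).  THEOREMS ONLY (no definition, no instance, no notation, no named fact, no `sorry`); datum-free (`K` any field with `Valued K ℤᵐ⁰`, any rank `N`,
any form `H`, any group `G` with a hom `ι : G →* GL_N(K)`).  Cell `pub/hodgecm-mathlib` (D-0151), crux H413 = `stmt-HodgeConjecture-24833`, organ (D-RAM) `stub_DyRamCore`,
«FOUR-FRAME» road, tier-1 unit U2G «census dictionary» (assembler B-p08 (g41)): the stubs `stub_U2G_dict_transvPlus ∕ transvMinus ∕ reg` of
`Cruxes/H413/Lines/F0_P3c_DyRamFourFrame/U2G_Census.lean` assert `Φ(⟦γ⟧, f; mG₃) = νG₃(K) · #{type-0 vertices M fixed by ι_w γ with LABEL(M)}` for the PROFILE PIECES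
`f = 1_{K ∩ {u | label(u)}}` (★ №3 `pieceTransvPlus ∕ pieceTransvMinus ∕ pieceReg`).  Their proof factors as ★ `classOrbitalIntegral_eq_sum_fixedBy_of_support_subset_of_conj_invariant`
(orbital integral = `ν(K) · Σ_{gK ∈ Fix_γ} f(g⁻¹γg)`, i.e. `ν(K) · #{gK ∈ Fix_γ | label(g⁻¹γg)}`) ∘ THIS FILE (the labelled coset count = the labelled fixed-vertex count, GIVEN that
the coset label `P` and the vertex label `Q` agree on fixed cosets) ∘ the label transports (`InLevel(g⁻¹Xg) ↔ LatticeInLevel X (g·𝒪³)`, value sets; next file) ∘ transitivity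
(htr₀-wild ★ p854568 ∕ p854598).  The unlabelled case `P = Q = ⊤` is ★ `natCard_fixedBy_quotient_eq_ncard_isVertexLattice` (B-p04).

THE MATHEMATICS ([Kottwitz1986, §3]; [Rogawski1990, §4.9 p. 54]; [Laumon1995, Lemma (5.3.2)]).  Let `G` act on the `𝒪`-submodules of `Kᴺ` through `ι : G →* GL_N(K)`,
`N₀` a lattice, `K_t = Stab_G(N₀)` (membership statement `u ∈ K_t ↔ ι(u)·N₀ = N₀`).  ★ B-p04: `gK_t ↦ ι(g)·N₀` is a bijection `Fix_γ(G ⧸ K_t) ≃ {M ∈ G·N₀ | γ·M = M}`.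
§1: if a coset predicate `P` (read on the conjugate `out(q)⁻¹ γ out(q)` of the chosen representative) and a lattice predicate `Q` satisfy
`P(g⁻¹γg) ↔ Q(ι(g)·N₀)` for every `g` whose vertex `ι(g)·N₀` is `γ`-fixed, the bijection restricts:
**`#{q ∈ Fix_γ(G ⧸ K_t) | P(out(q)⁻¹ γ out(q))} = #{M | M ∈ G·N₀ ∧ γ·M = M ∧ Q M}`** (`Set.ncard`; the hypothesis is only ever used at `g = out(q)`, so no
`K_t`-invariance of `P` needs to be stated separately).  §2: under type preservation + transitivity of `ι(G)` on the type-`t` vertices of the ★ lattice graph of `(Kᴺ, H)`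
the orbit `G·N₀` is the set of type-`t` vertices, so the right side is `#{M type t | γ·M = M ∧ Q M}`.  §3: the finsum reading `Σᶠ_{q ∈ Fix_γ} 1_{P}(…) = #{…}` used on the
orbital side (`ℂ`-valued).

* §1 `ncard_fixedBy_quotient_sep_eq_ncard_orbit_fixed_sep`.
* §2 `setOf_orbit_fixed_sep_eq_setOf_isVertexLattice_fixed_sep`, **`ncard_fixedBy_quotient_sep_eq_ncard_isVertexLattice_fixed_sep`**.
* §3 `finsum_mem_ite_one_zero_eq_ncard_sep` (`Σᶠ_{q ∈ s} (if p q then 1 else 0) = #(s ∩ {p})` in `ℂ`, finite `s`).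
HONEST LABEL: HC_CM is proved only modulo the 7 printed citations (2 remaining named inputs: hLiu418 = stmt-HodgeConjecture-24832, h413 = stmt-HodgeConjecture-24833) until rung 0
closes; this file is group∕lattice bookkeeping and moves nothing.

## References
* [Kottwitz1986] R. E. Kottwitz, *Base change for unit elements of Hecke algebras*, Compositio Math. 60 (1986), §3 (fixed cosets = stable lattices; strata).
* [Rogawski1990] J. D. Rogawski, *Automorphic Representations of Unitary Groups in Three Variables*, Ann. of Math. Stud. 123 (1990), §4.9 Prop. 4.9.1 (b) pp. 54–55.
* [Laumon1995] G. Laumon, *Cohomology of Drinfeld Modular Varieties I* (1996), (4.3.11) p. 83, Lemma (5.3.2) p. 136.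
-/

noncomputable section

open scoped Valued WithZero Matrix MatrixGroups
open Finset Classical

namespace Literature.NumberTheory.Automorphic.UnitaryThreeFourFrame

open Literature.NumberTheory.Automorphic Literature.NumberTheory.Automorphic.HermitianLattice
  Literature.NumberTheory.Automorphic.UnitaryLatticeTree

/-! ## §1  The labelled bijection on the orbit -/

section Orbit

variable {K : Type*} [Field K] [Valued K ℤᵐ⁰] {N : ℕ} {G : Type*} [Group G]
  (ι : G →* GL (Fin N) K) (N₀ : Submodule 𝒪[K] (Fin N → K)) (Kt : Subgroup G)

/-- **THE LABELLED DICTIONARY ON THE ORBIT**: if `P(g⁻¹γg) ↔ Q(ι(g)·N₀)` whenever `ι(γ)` fixes `ι(g)·N₀`, then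
`#{q ∈ Fix_γ(G ⧸ K_t) | P(out(q)⁻¹ γ out(q))} = #{M | (∃ u, ι(u)·N₀ = M) ∧ ι(γ)·M = M ∧ Q M}` (`K_t = Stab(N₀)` as a membership statement; `Set.ncard`).
[cite: Kottwitz1986, §3] [cite: Laumon1995, Lemma (5.3.2) p. 136] -/
theorem ncard_fixedBy_quotient_sep_eq_ncard_orbit_fixed_sep (hKt : ∀ u : G, u ∈ Kt ↔ mapGL (ι u) N₀ = N₀) (γ : G)
    (P : G → Prop) (Q : Submodule 𝒪[K] (Fin N → K) → Prop)
    (hPQ : ∀ g : G, mapGL (ι γ) (mapGL (ι g) N₀) = mapGL (ι g) N₀ → (P (g⁻¹ * γ * g) ↔ Q (mapGL (ι g) N₀))) :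
    {q : G ⧸ Kt | q ∈ MulAction.fixedBy (G ⧸ Kt) γ ∧ P (q.out⁻¹ * γ * q.out)}.ncard =
      {M : Submodule 𝒪[K] (Fin N → K) | (∃ u : G, mapGL (ι u) N₀ = M) ∧ mapGL (ι γ) M = M ∧ Q M}.ncard := by
  -- fixedness read at the chosen representative
  have hfix : ∀ q : G ⧸ Kt, q ∈ MulAction.fixedBy (G ⧸ Kt) γ → mapGL (ι γ) (mapGL (ι q.out) N₀) = mapGL (ι q.out) N₀ := by
    intro q hq
    have hq' : ((q.out : G) : G ⧸ Kt) ∈ MulAction.fixedBy (G ⧸ Kt) γ := by rw [QuotientGroup.out_eq']; exact hq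
    exact (mem_fixedBy_quotient_iff_mapGL_eq ι N₀ Kt hKt γ _).1 hq'
  refine Set.ncard_congr (fun q _ => mapGL (ι q.out) N₀) ?_ ?_ ?_
  · -- maps into the labelled fixed orbit
    rintro q ⟨hq, hP⟩
    exact ⟨⟨q.out, rfl⟩, hfix q hq, (hPQ q.out (hfix q hq)).1 hP⟩
  · -- injective: `ι(out q)·N₀ = ι(out q′)·N₀ ⇒ (out q′)⁻¹ out q ∈ Stab(N₀) ⇒ q = q′`
    rintro q q' - - hqq'
    rw [← QuotientGroup.out_eq' q, ← QuotientGroup.out_eq' q', QuotientGroup.eq, hKt, map_mul, map_inv, mapGL_mul, ← hqq', ← mapGL_mul,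
      inv_mul_cancel, mapGL_one]
  · -- surjective: a labelled fixed `M = ι(u)·N₀` comes from the fixed coset `uK_t`, whose representative has the same vertex
    rintro M ⟨⟨u, rfl⟩, hγM, hQ⟩
    have hu : (u : G ⧸ Kt) ∈ MulAction.fixedBy (G ⧸ Kt) γ := (mem_fixedBy_quotient_iff_mapGL_eq ι N₀ Kt hKt γ u).2 hγM
    have hout : mapGL (ι ((u : G ⧸ Kt).out)) N₀ = mapGL (ι u) N₀ := mapGL_out_eq ι N₀ Kt hKt u
    refine ⟨(u : G ⧸ Kt), ⟨hu, ?_⟩, hout⟩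
    rw [hPQ _ (hfix _ hu), hout]
    exact hQ

end Orbit

/-! ## §2  Under type preservation + transitivity: the orbit is the set of type-`t` vertices -/

section Vertices

variable {K : Type*} [Field K] [Valued K ℤᵐ⁰] {N : ℕ} {G : Type*} [Group G]
  (ι : G →* GL (Fin N) K) (N₀ : Submodule 𝒪[K] (Fin N → K)) (Kt : Subgroup G)
  (σ : K →+* K) (ϖ : K) (H : Matrix (Fin N) (Fin N) K) (t : ℕ)

/-- The labelled fixed members of the orbit `G·N₀` = the labelled fixed type-`t` vertices, when `ι(G)` preserves and is transitive on the type-`t` vertices.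
[cite: Kottwitz1986, §3] [cite: Rogawski1990, §4.9 Prop. 4.9.1 (b) p. 55] -/
theorem setOf_orbit_fixed_sep_eq_setOf_isVertexLattice_fixed_sep (htype : ∀ u : G, IsVertexLattice σ ϖ H t (mapGL (ι u) N₀))
    (htr : ∀ M : Submodule 𝒪[K] (Fin N → K), IsVertexLattice σ ϖ H t M → ∃ u : G, mapGL (ι u) N₀ = M) (γ : G)
    (Q : Submodule 𝒪[K] (Fin N → K) → Prop) :
    {M : Submodule 𝒪[K] (Fin N → K) | (∃ u : G, mapGL (ι u) N₀ = M) ∧ mapGL (ι γ) M = M ∧ Q M} =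
      {M : Submodule 𝒪[K] (Fin N → K) | IsVertexLattice σ ϖ H t M ∧ mapGL (ι γ) M = M ∧ Q M} := by
  ext M
  simp only [Set.mem_setOf_eq]
  constructor
  · rintro ⟨⟨u, rfl⟩, h, hQ⟩
    exact ⟨htype u, h, hQ⟩
  · rintro ⟨hM, h, hQ⟩
    exact ⟨htr M hM, h, hQ⟩

/-- **THE LABELLED DICTIONARY**: `#{q ∈ Fix_γ(G ⧸ K_t) | P(out(q)⁻¹ γ out(q))} = #{M type t | ι(γ)·M = M ∧ Q M}` — given the stabiliser clause, type preservation,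
transitivity on the type-`t` vertices, and `P(g⁻¹γg) ↔ Q(ι(g)·N₀)` on fixed cosets.  (The unlabelled case is ★ `natCard_fixedBy_quotient_eq_ncard_isVertexLattice`.)
[cite: Kottwitz1986, §3] [cite: Rogawski1990, §4.9 Prop. 4.9.1 (b) p. 55] [cite: Laumon1995, Lemma (5.3.2) p. 136] -/
theorem ncard_fixedBy_quotient_sep_eq_ncard_isVertexLattice_fixed_sep (hKt : ∀ u : G, u ∈ Kt ↔ mapGL (ι u) N₀ = N₀)
    (htype : ∀ u : G, IsVertexLattice σ ϖ H t (mapGL (ι u) N₀))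
    (htr : ∀ M : Submodule 𝒪[K] (Fin N → K), IsVertexLattice σ ϖ H t M → ∃ u : G, mapGL (ι u) N₀ = M) (γ : G)
    (P : G → Prop) (Q : Submodule 𝒪[K] (Fin N → K) → Prop)
    (hPQ : ∀ g : G, mapGL (ι γ) (mapGL (ι g) N₀) = mapGL (ι g) N₀ → (P (g⁻¹ * γ * g) ↔ Q (mapGL (ι g) N₀))) :
    {q : G ⧸ Kt | q ∈ MulAction.fixedBy (G ⧸ Kt) γ ∧ P (q.out⁻¹ * γ * q.out)}.ncard =
      {M : Submodule 𝒪[K] (Fin N → K) | IsVertexLattice σ ϖ H t M ∧ mapGL (ι γ) M = M ∧ Q M}.ncard := by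
  rw [ncard_fixedBy_quotient_sep_eq_ncard_orbit_fixed_sep ι N₀ Kt hKt γ P Q hPQ,
    setOf_orbit_fixed_sep_eq_setOf_isVertexLattice_fixed_sep ι N₀ σ ϖ H t htype htr γ Q]

end Vertices

/-! ## §3  The finsum reading used on the orbital side -/

section Finsum

variable {α : Type*}

/-- `Σᶠ_{q ∈ s} (if p q then 1 else 0) = #(s ∩ {q | p q})` in `ℂ`, for a FINITE `s` (the weighted fixed-coset sum of a labelled indicator). [cite: Laumon1995, Lemma (5.3.2) p. 136] -/
theorem finsum_mem_ite_one_zero_eq_ncard_sep (s : Set α) (hs : s.Finite) (p : α → Prop) :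
    ∑ᶠ q ∈ s, (if p q then (1 : ℂ) else 0) = (({q | q ∈ s ∧ p q} : Set α).ncard : ℂ) := by
  have hst : ({q | q ∈ s ∧ p q} : Set α) = s ∩ {q | p q} := by
    ext q; simp only [Set.mem_setOf_eq, Set.mem_inter_iff]
  have hfin : (s ∩ {q | p q}).Finite := hs.inter_of_left _
  rw [finsum_mem_eq_finite_toFinset_sum _ hs, Finset.sum_boole, hst, Set.ncard_eq_toFinset_card _ hfin]
  congr 2
  ext q
  simp only [Finset.mem_filter, Set.Finite.mem_toFinset, Set.mem_inter_iff, Set.mem_setOf_eq]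

end Finsum

end Literature.NumberTheory.Automorphic.UnitaryThreeFourFrame

end
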